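import Summits.QuantumFields.YangMills.Theses.SandwichVariancePinching
import Summits.QuantumFields.YangMills.Theorems.LogConcaveChartTransportIsotropicReduction
import Summits.QuantumFields.YangMills.Theorems.SandwichVariancePinchingFloorWhitening

/-!
# Route `SandwichVariancePinching` — crux `QuadraticVarianceCeiling` (stmt-QuantumFields-28259):
# **WHITENING** — the ceiling in the isotropic frame `H₀ = 1` implies the ceiling for every `H₀ ≻ 0`

`quadraticVarianceCeiling_of_whitened`: mirror image of `…FloorWhitening.quadraticVarianceFloor_of_whitened`
(conjugation by `P = H₀^{1/2}`; the Gibbs ratios and `rV` are frame invariant, the sandwich and the centring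
transport — `Cruxes.TransportCovarianceTransfer.{exists_symm_sqrt, sandwich_conj, integral_div_comp_mulVec,
trace_conj_mul_conj, conj_dotProduct_conj, quadObs_conj}`, `centring_conj`).  The whitened ceiling is the
hypothesis, written out (the planner's `CeilingWhitened`, no new definition).

HONEST SCOPE.  Free-hands work of the LEAD seat of crux stmt-QuantumFields-22884 (cell ym-idea-1).  A reduction
only; it does NOT prove the whitened ceiling, hence not `QuadraticVarianceCeiling`,
`LogConcaveChart.QuadraticCovarianceComparison` (26240), rung R2a or any summit statement; the Yang–Mills mass gap
is NOT proved by any of this.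
-/

noncomputable section

namespace Summit.QuantumFields.YangMills.Theorems.SandwichVariancePinching

open MeasureTheory Real Matrix
open Summit.QuantumFields.YangMills.Cruxes.TransportCovarianceTransfer

variable {n : ℕ}

/-- **WHITENING FOR THE VARIANCE CEILING**: the ceiling in the frame `H₀ = 1` (hypothesis, = the planner's
`CeilingWhitened`) implies the crux `QuadraticVarianceCeiling` for every positive definite `H₀`. [folklore] -/
theorem quadraticVarianceCeiling_of_whitened
    (hw : ∃ (C δ₀ : ℝ), 0 ≤ C ∧ 0 < δ₀ ∧ δ₀ ≤ 1 ∧ ∀ δ : ℝ, 0 ≤ δ → δ ≤ δ₀ →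
      ∀ (n : ℕ) (H : Matrix (Fin n) (Fin n) ℝ) (b : Fin n → ℝ) (A : (Fin n → ℝ) → ℝ),
        H.IsSymm → Continuous A →
        (∀ x h : Fin n → ℝ, (1 - δ) * (h ⬝ᵥ h) ≤ A (x + h) + A (x - h) - 2 * A x ∧
          A (x + h) + A (x - h) - 2 * A x ≤ (1 + δ) * (h ⬝ᵥ h)) →
        (∀ i : Fin n, ∫ x, x i * Real.exp (-A x) = 0) →
        (∫ x, (x ⬝ᵥ H.mulVec x + b ⬝ᵥ x) * (x ⬝ᵥ H.mulVec x + b ⬝ᵥ x) * Real.exp (-A x)) /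
              (∫ x, Real.exp (-A x)) -
            (∫ x, (x ⬝ᵥ H.mulVec x + b ⬝ᵥ x) * Real.exp (-A x)) / (∫ x, Real.exp (-A x)) *
              ((∫ x, (x ⬝ᵥ H.mulVec x + b ⬝ᵥ x) * Real.exp (-A x)) / (∫ x, Real.exp (-A x))) ≤
          (1 + C * δ) * (2 * (H * H).trace + b ⬝ᵥ b)) :
    Summit.QuantumFields.YangMills.Theses.SandwichVariancePinching.QuadraticVarianceCeiling := by
  obtain ⟨C, δ₀, hC, hδ₀, hδ₀1, hw⟩ := hw
  refine ⟨C, min δ₀ (1 / 2), hC, lt_min hδ₀ (by norm_num), (min_le_left _ _).trans hδ₀1, ?_⟩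
  intro δ hδ hδm n H₀ H b A hH₀ hH hA hsw hcent gE q rV
  have hδ₀' : δ ≤ δ₀ := hδm.trans (min_le_left _ _)
  have hδ1 : δ < 1 := lt_of_le_of_lt (hδm.trans (min_le_right _ _)) (by norm_num)
  obtain ⟨P, hPs, hP, hPP⟩ := exists_symm_sqrt hH₀
  have hQs : P⁻¹.IsSymm := isSymm_inv hPs
  have hQQ : P⁻¹ * P⁻¹ = H₀⁻¹ := by rw [← Matrix.mul_inv_rev, hPP]
  have hQdet : (P⁻¹).det ≠ 0 := by
    rw [Matrix.det_nonsing_inv, Ring.inverse_eq_inv']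
    exact inv_ne_zero hP
  -- the whitened potential
  set At : (Fin n → ℝ) → ℝ := fun y => A (P⁻¹ *ᵥ y) with hAt
  have hAtc : Continuous At := hA.comp (Matrix.mulVecLin P⁻¹).toContinuousLinearMap.continuous
  have hswt : ∀ y k : Fin n → ℝ, (1 - δ) * (k ⬝ᵥ k) ≤ At (y + k) + At (y - k) - 2 * At y ∧
      At (y + k) + At (y - k) - 2 * At y ≤ (1 + δ) * (k ⬝ᵥ k) := fun y k =>
    sandwich_conj hPs hP hPP hsw y k
  -- centring of the whitened potential (integrability from the repaired `SandwichMoments`)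
  have hmom := sandwichMoments_of_lt_one δ hδ hδ1 n H₀ A hH₀ hA hsw
  have hint : ∀ i : Fin n, Integrable fun x : Fin n → ℝ => x i * exp (-A x) := fun i => by
    have h := (hmom.2.2 0 0 (Pi.single i 1) 0).1
    refine h.congr (ae_of_all _ fun x => ?_)
    simp [Matrix.zero_mulVec]
  have hcentt : ∀ i : Fin n, ∫ y, y i * exp (-At y) = 0 := fun i =>
    centring_conj hP hint hcent i
  -- the floor in the whitened frame
  have key := hw δ hδ hδ₀' n (P⁻¹ * H * P⁻¹) (P⁻¹ *ᵥ b) At (isSymm_conj hQs hH) hAtc hswt hcentt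
  -- identify the constants
  rw [trace_conj_mul_conj _ _ _ _ hQQ, conj_dotProduct_conj hQs hQQ] at key
  -- identify the Gibbs ratios: `q̃(y) = q(P⁻¹ y)` and the Jacobian cancels
  simp only [quadObs_conj hQs, hAt] at key
  have r1 := integral_div_comp_mulVec hQdet
    (fun x => (x ⬝ᵥ H *ᵥ x + b ⬝ᵥ x) * (x ⬝ᵥ H *ᵥ x + b ⬝ᵥ x) * exp (-A x)) (fun x => exp (-A x))
  have r2 := integral_div_comp_mulVec hQdet
    (fun x => (x ⬝ᵥ H *ᵥ x + b ⬝ᵥ x) * exp (-A x)) (fun x => exp (-A x))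
  rw [r1, r2] at key
  exact key

end Summit.QuantumFields.YangMills.Theorems.SandwichVariancePinching

end
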